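import Summits.QuantumFields.YangMills.Theorems.UnitScaleTiltProp7SymFrameLinearResponseStepT3
import Summits.QuantumFields.YangMills.Theorems.UnitScaleTiltProp7SymFrameBound
import Summits.QuantumFields.YangMills.Theorems.UnitScaleTiltProp7SymAvgRelativeDiff
import Summits.QuantumFields.YangMills.Theorems.UnitScaleTiltProp7HolRatioLinearResponse
import HarnessLib

/-!
# Route `UnitScaleTilt`, crux K1 «MinimiserStabilityRegPr» (stmt-QuantumFields-19200), route-R E′ (A′)-on-Σ, P-A2-COMB (β), item «R0-RECURSION» (★★OWNER RULINGS №19∕№20; px13 g6's pen),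
# sub-brick R0-LIN-S FILE 2 — THE DIFFERENTIABILITY ROWS `hT`∕`hF` OF ✓`Prop7SymFrameLinearResponseStep` DISCHARGED AT A PRINTED-REGULAR BACKGROUND, EVERY LEVEL `k ≤ K − n`:
# the plain symmetric tower `A ↦ Ū⁽ᵏ⁾[e^{A}·W♭](e)` and the accumulated symmetric frames `A ↦ v_k(W♭; e^{A}·W♭)(x)` are ℂ-differentiable at `A = 0`; hence the derivative
# recursion `fderiv v_{k+1} = |Idx|⁻¹ Σ_i (fderiv R_{k,i} + Ad_{ν_i} fderiv v_k(x_i))` holds at the member with NO displayed hypothesis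

Cell `ym3-torus`, twin-width seat `ym-routeR-w2` (gen 9); px13 g6 05:57:58Z «YES please “routeR-w2: discharge” the `hT`∕`hF` rows `_of_regPr` as your FILE 2 — F-γ consumes them».
THEOREMS ONLY (0 `def`, 0 `sorry`); `--supports stmt-QuantumFields-19200 --as helper`, count-neutral.  YM₃ on T³ is a ladder rung (R3), not the Clay problem; nothing here claims the stub,
the crux, (β), `hPA2`, `hcoS`, d = 4 or the mass gap.

THE POINT.  ✓R0-LIN-S (`Prop7SymFrameLinearResponseStep.fderiv_coe_frameAccU_succ_apply`) displays two differentiability rows per level: `hT` (the plain tower's level-`k` bonds) and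
`hF` (the level-`k` accumulated frames).  At the member — background `W` with `RegPr F n K ε₀ W` and the (β) lane's k-UNIFORM window `10¹²L³ε₀ ≤ 1` — both hold at `A = 0` for EVERY
`k ≤ K − n`, by the cell's landed analyticity rows in the cluster axial gauge: ✓`Prop7SymFrameBound.analyticAt_coe_frameAccU_of_plaqSmall` (frames; W2's one-step rows
✓`hstep_of_W1`∕`hframe_of_W1`) and ✓`Prop7SymAvgRelativeBound.differentiableAt_relIter_of_plaqSmall` (plain tower, relative form), both at the base point `A₀ = 0` (`t = 0`), with
the level-`k` budgets `6400ℓ²Lᵏs_B(k) ≤ 1`, `8(16C₁+2)ℓ²Lᵏ·30ℓs_B(k) ≤ 1`, `16ℓ(60ℓ + 30ℓ)Lᵏs_B(k) ≤ 1` (`s_B(k) = 6(3Lᵏ − 1)a₀`, `a₀ = ε₀L^{−2(K−n)}`) — all consequences of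
`Lᵏs_B(k) ≤ 18ε₀` (monotone in `k ≤ K − n`) and the window (§1).  The plain tower is read through print's chart `e^{iηA′}` (`Prop8Chart.expCfg 1`) at `A′ = −i·A` (§2, a linear
change of variable).
* §1 `level_budget_of_regPr` — the level-`k` arithmetic.
* §2 `expCfg_one_negI_smul_eq` (`e^{i·1·(−iA)} = e^{A}` bondwise, as units fields), ★★ `differentiableAt_coe_emlIterU_of_regPr` (= `hT` at every `k ≤ K − n`),
  ★★ `differentiableAt_coe_frameAccU_of_regPr` (= `hF` at every `k ≤ K − n`).
* §4 ★★★ `fderiv_stairRatio_apply_of_regPr` ∕ ★★★ `fderiv_frameAccU_succ_apply_covWalkSum_of_regPr` — with ✓FILE 3 (`Prop7HolRatioLinearResponse.fderiv_holT_ratio_apply`): the stair-ratio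
  derivative IS `covWalkSum V ℓY Γ_i(y)` for ANY level-`k` `SU(2)` field `V` carrying the background tower's values (`hV : ↑(Ū⁽ᵏ⁾[W♭](b)) = ↑(V b)` — ✓px17
  `emlIterU_eq_unitsField_iter`), so px13's F-γ2 row `hℓ` is inhabited by `ℓ := fderiv … 0 A`, `ℓY l b := fderiv ℂ (t ↦ ↑(Ū⁽ˡ⁾[e^{t}·W♭](b))) 0 A · (↑(V b))*` TOKEN FOR TOKEN.
* §3 ★★★ `fderiv_frameAccU_succ_apply_of_regPr` — ✓R0-LIN-S's applied recursion at the member with `hT`∕`hF` DISCHARGED (`k + 1 ≤ K − n`): px13's `ℓ`-recursion for `ℓ := fderiv … 0 A`,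
  hypothesis-free but for `RegPr` and the window; ★★ `fderiv_vframeCovU_succ_apply_of_regPr` (one-step frame); `differentiableAt_stairRatio_of_regPr` (FILE 3's `hW` input for the
  plain-tower stair ratios).
HONEST SCOPE.  Window arithmetic + two landed analyticity rows; no estimate beyond differentiability, no currency; nothing of print asserted; (R0), REM2ˢ, (β), `hD`, `hPA2`, `hcoS`, the
stub and the crux are NOT advanced analytically by this file.

References: T. Bałaban, CMP 98 (1985) 17–51 [Balaban1985Averaging] ((11)–(12) p.19, (82) p.30, (97) p.32, Prop. 4 (134)–(135) p.38, (159)–(163) p.42); CMP 109 (1987) 249–301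
[Balaban1987RG1] ((0.4)–(0.8) p.253, (0.21) p.256); CMP 102 (1985) 277–309 [Balaban1985Variational] ((2) p.278, (152) p.301).
-/

set_option autoImplicit false

noncomputable section

open scoped Matrix.Norms.L2Operator BigOperators

namespace Summit.QuantumFields.YangMills.Theorems.Prop7SymFrameLinearResponseOfRegPr

open NormedSpace
open Literature.MathematicalPhysics.QuantumFieldTheory.Balaban1983to89
open Literature.MathematicalPhysics.QuantumFieldTheory.Balaban1983to89.T3ContinuumYM3Torus
open T4Continuum BlockAveraging
open T3PrintedRegularMinimiser (RegPr)
open T3SectALandauChart (bgUnits)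
open T3RegularMinimiser (regThreshold)
open B7Prop1Explicit (expUnit val_expUnit disp)
open B10Eq27TorusAxialLog (holT unitsField toUField transl)
open Summit.QuantumFields.YangMills.Theorems.Prop8Chart (expCfg coe_expCfg emlIterU)
open Summit.QuantumFields.YangMills.Theorems.Prop7SymAvgTwSym (frameAccU vframeCovU dbarCovIterU)
open Summit.QuantumFields.YangMills.Theorems.Prop7SymFrameBound (analyticAt_coe_frameAccU_of_plaqSmall hstep_of_W1 hframe_of_W1 bgUnits_eq_unitsField)
open Summit.QuantumFields.YangMills.Theorems.Prop7SymAvgRelativeBound (differentiableAt_relIter_of_plaqSmall)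
open Summit.QuantumFields.YangMills.Theorems.Prop7SymAvgGL (expUnit_zero_mul_bgUnits)
open Summit.QuantumFields.YangMills.Theorems.Prop7SymFrameLinearResponseStep (fderiv_coe_frameAccU_succ_apply fderiv_coe_vframeCovU_succ_apply differentiableAt_stairRatio)
open Summit.QuantumFields.YangMills.Theorems.Prop7HolRatioLinearResponse (fderiv_holT_ratio_apply)
open BlockAveragingEMLLinearisedBackground (covWalkSum)

variable (F : T3Family) {n K : ℕ}

/-! ## §1 The level-`k` budgets from the k-uniform window -/

/-- **THE LEVEL-`k` BUDGETS AT A PRINTED-REGULAR BACKGROUND** (`k ≤ K − n`, `10¹²L³ε₀ ≤ 1`, `a₀ = regThreshold = ε₀L^{−2(K−n)}`, `s_B(k) = 2·(3·(3Lᵏ − 1))·a₀`, `ℓ = 5L`, `C₁ = 22100`):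
`Lᵏ·s_B(k) ≤ 18ε₀`, hence the three budgets of ✓`analyticAt_coe_frameAccU_of_plaqSmall` at `t = 0` and the budget of ✓`differentiableAt_relIter_of_plaqSmall` at `t = 0`.
[cite: Balaban1985Averaging, Prop. 4 (134)–(135) p.38; Balaban1985Variational, (2) p.278] -/
theorem level_budget_of_regPr {ε₀ : ℝ} (hε₀ : 0 < ε₀) (hε : 10 ^ 12 * (F.L : ℝ) ^ 3 * ε₀ ≤ 1) {k : ℕ} (hk : k ≤ K - n) :
    0 < regThreshold F n K ε₀ ∧
    6400 * ((((F.P K).d + 2) * (F.P K).L : ℕ) : ℝ) ^ 2 * ((F.P K).L : ℝ) ^ k *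
        (2 * (((F.P K).d : ℝ) * (3 * ((F.P K).L : ℝ) ^ k - 1)) * regThreshold F n K ε₀) ≤ 1 ∧
    8 * (16 * (22100 : ℝ) + 2) * ((((F.P K).d + 2) * (F.P K).L : ℕ) : ℝ) ^ 2 *
        (((F.P K).L : ℝ) ^ k * (2 * 0 + 30 * ((((F.P K).d + 2) * (F.P K).L : ℕ) : ℝ) * (2 * (((F.P K).d : ℝ) * (3 * ((F.P K).L : ℝ) ^ k - 1)) * regThreshold F n K ε₀))) ≤ 1 ∧
    16 * ((((F.P K).d + 2) * (F.P K).L : ℕ) : ℝ) *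
        (2 * (((F.P K).L : ℝ) ^ k * (2 * 0 + 30 * ((((F.P K).d + 2) * (F.P K).L : ℕ) : ℝ) * (2 * (((F.P K).d : ℝ) * (3 * ((F.P K).L : ℝ) ^ k - 1)) * regThreshold F n K ε₀))) +
          30 * ((((F.P K).d + 2) * (F.P K).L : ℕ) : ℝ) * ((F.P K).L : ℝ) ^ k * (2 * (((F.P K).d : ℝ) * (3 * ((F.P K).L : ℝ) ^ k - 1)) * regThreshold F n K ε₀)) ≤ 1 ∧
    6400 * ((((F.P K).d + 2) * (F.P K).L : ℕ) : ℝ) ^ 2 * ((F.P K).L : ℝ) ^ k *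
        (2 * 0 * (1 + 2 * (((F.P K).d : ℝ) * (3 * ((F.P K).L : ℝ) ^ k - 1)) * regThreshold F n K ε₀) +
          2 * (((F.P K).d : ℝ) * (3 * ((F.P K).L : ℝ) ^ k - 1)) * regThreshold F n K ε₀) ≤ 1 := by
  have hd : (F.P K).d = 3 := T3Family.P_d F K
  have hLn : (F.P K).L = F.L := rfl
  have hL3 : 3 ≤ F.L := by obtain ⟨a, ha⟩ := F.hL.1; have := F.hL.2; omega
  have hL3r : (3 : ℝ) ≤ F.L := by exact_mod_cast hL3
  have hL0 : (0 : ℝ) < F.L := by linarith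
  have hL1 : (1 : ℝ) ≤ F.L := by linarith
  set X : ℝ := (F.L : ℝ) ^ (K - n) with hX
  set Y : ℝ := (F.L : ℝ) ^ k with hY
  have hY1 : 1 ≤ Y := one_le_pow₀ hL1
  have hYX : Y ≤ X := pow_le_pow_right₀ hL1 hk
  have hX0 : 0 < X := by positivity
  set a₀ : ℝ := regThreshold F n K ε₀ with ha₀
  have ha₀0 : 0 < a₀ := by rw [ha₀]; unfold regThreshold; positivity
  have hXa : X * (X * a₀) = ε₀ := by
    have hX2 : X * X = (F.L : ℝ) ^ (2 * (K - n)) := by rw [hX, ← pow_add, two_mul]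
    have ha : a₀ = ε₀ * ((F.L : ℝ) ^ (2 * (K - n)))⁻¹ := by rw [ha₀]; unfold regThreshold; rw [inv_pow]
    rw [← mul_assoc, hX2, ha, mul_comm ε₀, ← mul_assoc, mul_inv_cancel₀ (pow_ne_zero _ hL0.ne'), one_mul]
  -- the one quantity: `Z := Lᵏ·s_B(k) ≤ 18ε₀`
  set Z : ℝ := Y * (2 * ((3 : ℝ) * (3 * Y - 1)) * a₀) with hZ
  have hZ0 : 0 ≤ Z := by
    rw [hZ]; have : (0 : ℝ) ≤ 3 * Y - 1 := by linarith
    positivity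
  have hZ18 : Z ≤ 18 * ε₀ := by
    have h1 : Z ≤ 18 * (Y * (Y * a₀)) := by rw [hZ]; nlinarith [mul_nonneg (by linarith : (0:ℝ) ≤ Y) ha₀0.le]
    have h2 : Y * (Y * a₀) ≤ X * (X * a₀) := by
      have := mul_le_mul hYX (mul_le_mul_of_nonneg_right hYX ha₀0.le) (by positivity) hX0.le
      exact this
    linarith
  have hℓ : ((((3 : ℕ) + 2) * F.L : ℕ) : ℝ) = 5 * F.L := by push_cast; ring
  have hL3ε : (F.L : ℝ) ^ 3 * ε₀ ≤ 1 / 10 ^ 12 := by rw [le_div_iff₀ (by positivity)]; linarith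
  have hL2ε : (F.L : ℝ) ^ 2 * ε₀ ≤ 1 / 10 ^ 12 :=
    le_trans (mul_le_mul_of_nonneg_right (pow_le_pow_right₀ hL1 (by norm_num)) hε₀.le) hL3ε
  rw [hd, hLn]
  refine ⟨ha₀0, ?_, ?_, ?_, ?_⟩
  · rw [hℓ]
    have : 6400 * (5 * (F.L : ℝ)) ^ 2 * Y * (2 * (((3 : ℕ) : ℝ) * (3 * Y - 1)) * a₀) = 160000 * (F.L : ℝ) ^ 2 * Z := by rw [hZ]; push_cast; ring
    rw [this]; nlinarith [sq_nonneg (F.L : ℝ)]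
  · rw [hℓ]
    have : 8 * (16 * (22100 : ℝ) + 2) * (5 * (F.L : ℝ)) ^ 2 * (Y * (2 * 0 + 30 * (5 * (F.L : ℝ)) * (2 * (((3 : ℕ) : ℝ) * (3 * Y - 1)) * a₀)))
        = 10608060000 * (F.L : ℝ) ^ 3 * Z := by rw [hZ]; push_cast; ring
    rw [this]; nlinarith [pow_nonneg hL0.le 3]
  · rw [hℓ]
    have : 16 * (5 * (F.L : ℝ)) * (2 * (Y * (2 * 0 + 30 * (5 * (F.L : ℝ)) * (2 * (((3 : ℕ) : ℝ) * (3 * Y - 1)) * a₀))) +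
        30 * (5 * (F.L : ℝ)) * Y * (2 * (((3 : ℕ) : ℝ) * (3 * Y - 1)) * a₀)) = 36000 * (F.L : ℝ) ^ 2 * Z := by rw [hZ]; push_cast; ring
    rw [this]; nlinarith [sq_nonneg (F.L : ℝ)]
  · rw [hℓ]
    have : 6400 * (5 * (F.L : ℝ)) ^ 2 * Y * (2 * 0 * (1 + 2 * (((3 : ℕ) : ℝ) * (3 * Y - 1)) * a₀) + 2 * (((3 : ℕ) : ℝ) * (3 * Y - 1)) * a₀)
        = 160000 * (F.L : ℝ) ^ 2 * Z := by rw [hZ]; push_cast; ring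
    rw [this]; nlinarith [sq_nonneg (F.L : ℝ)]

/-! ## §2 ★★ The two differentiability rows at every level -/

/-- **PRINT's CHART AT `A′ = −i·A` IS THE ROUTE's EXPONENTIAL**: `e^{i·1·(−i·A(b))} = e^{A(b)}` bondwise, as units fields times the background. [cite: Balaban1985Variational, (152) p.301] -/
theorem expCfg_one_negI_smul_eq (U : GaugeField (F.P K) 0 (Matrix (Fin 2) (Fin 2) ℂ)ˣ) (A : PBond (F.P K) 0 → Matrix (Fin 2) (Fin 2) ℂ) :
    (fun b => expCfg 1 (fun b' => (-Complex.I) • A b') b * U b) = fun b => expUnit (A b) * U b := by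
  funext b
  congr 1
  apply Units.ext
  rw [coe_expCfg, val_expUnit, smul_smul]
  have : Complex.I * ((1 : ℝ) : ℂ) * -Complex.I = 1 := by
    rw [Complex.ofReal_one, mul_one, mul_neg, Complex.I_mul_I, neg_neg]
  rw [this, one_smul]

variable {F}

/-- ★★ **`hT` DISCHARGED — THE PLAIN SYMMETRIC TOWER's LEVEL-`k` BONDS `A ↦ Ū⁽ᵏ⁾[e^{A}·W♭](e)` ARE ℂ-DIFFERENTIABLE AT `A = 0`** for every `k ≤ K − n`, at a printed-regular background
with `10¹²L³ε₀ ≤ 1` (✓`differentiableAt_relIter_of_plaqSmall` at `A₀ = 0`, `t = 0`, `η = 1`, read at `A′ = −iA`, times the constant `Ū⁽ᵏ⁾[W♭](e)`).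
[cite: Balaban1987RG1, (0.4) p.253, (0.21) p.256; Balaban1985Averaging, (11)–(12) p.19, Prop. 4 (134)–(135) p.38] -/
theorem differentiableAt_coe_emlIterU_of_regPr {ε₀ : ℝ} (hε₀ : 0 < ε₀) (hε : 10 ^ 12 * (F.L : ℝ) ^ 3 * ε₀ ≤ 1)
    (W : GaugeField (F.P K) 0 (Matrix.specialUnitaryGroup (Fin 2) ℂ)) (hreg : RegPr F n K ε₀ W) {k : ℕ} (hk : k ≤ K - n) (e : PBond (F.P K) k) :
    DifferentiableAt ℂ (fun A : PBond (F.P K) 0 → Matrix (Fin 2) (Fin 2) ℂ =>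
      ((emlIterU k (fun b => expUnit (A b) * bgUnits F K W b) e : (Matrix (Fin 2) (Fin 2) ℂ)ˣ) : Matrix (Fin 2) (Fin 2) ℂ)) 0 := by
  obtain ⟨ha₀0, -, -, -, hbud⟩ := level_budget_of_regPr F (n := n) (K := K) hε₀ hε hk
  have hk1 : k + 1 ≤ (F.P K).m + (F.P K).K := by
    show k + 1 ≤ F.m + K; have := F.hm; omega
  -- the linear change of variable `A ↦ −i·A`
  set φ : (PBond (F.P K) 0 → Matrix (Fin 2) (Fin 2) ℂ) →L[ℂ] (PBond (F.P K) 0 → Matrix (Fin 2) (Fin 2) ℂ) :=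
    (-Complex.I) • ContinuousLinearMap.id ℂ (PBond (F.P K) 0 → Matrix (Fin 2) (Fin 2) ℂ) with hφ
  have hφ0 : φ 0 = 0 := map_zero φ
  have hφapp : ∀ A, φ A = fun b => (-Complex.I) • A b := fun A => by
    rw [hφ]; rfl
  -- the relative plain tower in print's chart is differentiable at `φ 0 = 0`
  have hrel := differentiableAt_relIter_of_plaqSmall (P := F.P K) hk1 W ha₀0 hreg.1 1 (0 : PBond (F.P K) 0 → Matrix (Fin 2) (Fin 2) ℂ) (t := 0) zero_le_one
    (fun b => by simp) hbud e
  rw [← hφ0] at hrel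
  have hcomp := hrel.comp (0 : PBond (F.P K) 0 → Matrix (Fin 2) (Fin 2) ℂ) φ.differentiableAt
  -- multiply back by the constant background tower bond
  have hmul := hcomp.mul_const (((emlIterU k (unitsField (toUField W)) e : (Matrix (Fin 2) (Fin 2) ℂ)ˣ) : Matrix (Fin 2) (Fin 2) ℂ))
  refine hmul.congr_of_eventuallyEq (Filter.Eventually.of_forall fun A => ?_)
  simp only [Function.comp_apply, hφapp, expCfg_one_negI_smul_eq, bgUnits_eq_unitsField, mul_assoc, Units.inv_mul, mul_one]

/-- ★★ **`hF` DISCHARGED — THE ACCUMULATED SYMMETRIC FRAMES `A ↦ v_k(W♭; e^{A}·W♭)(x)` ARE ℂ-DIFFERENTIABLE AT `A = 0`** for every `k ≤ K − n`, at a printed-regular background with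
`10¹²L³ε₀ ≤ 1` (✓`analyticAt_coe_frameAccU_of_plaqSmall` at `A₀ = 0`, `t = 0`, W2's rows ✓`hstep_of_W1`∕`hframe_of_W1`, §1's budgets).
[cite: Balaban1985Averaging, (97) p.32, (159)–(163) p.42, Prop. 4 (134)–(135) p.38] -/
theorem differentiableAt_coe_frameAccU_of_regPr {ε₀ : ℝ} (hε₀ : 0 < ε₀) (hε : 10 ^ 12 * (F.L : ℝ) ^ 3 * ε₀ ≤ 1)
    (W : GaugeField (F.P K) 0 (Matrix.specialUnitaryGroup (Fin 2) ℂ)) (hreg : RegPr F n K ε₀ W) {k : ℕ} (hk : k ≤ K - n) (x : Site (F.P K) k) :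
    DifferentiableAt ℂ (fun A : PBond (F.P K) 0 → Matrix (Fin 2) (Fin 2) ℂ =>
      ((frameAccU k (bgUnits F K W) (fun b => expUnit (A b) * bgUnits F K W b) x : (Matrix (Fin 2) (Fin 2) ℂ)ˣ) : Matrix (Fin 2) (Fin 2) ℂ)) 0 := by
  obtain ⟨ha₀0, hbud₀, hbud, hρ, -⟩ := level_budget_of_regPr F (n := n) (K := K) hε₀ hε hk
  have hk1 : k + 1 ≤ (F.P K).m + (F.P K).K := by
    show k + 1 ≤ F.m + K; have := F.hm; omega
  have h3 := analyticAt_coe_frameAccU_of_plaqSmall (P := F.P K) (C₁ := 22100) (by norm_num) hstep_of_W1 hframe_of_W1 hk1 W ha₀0 hreg.1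
    (0 : PBond (F.P K) 0 → Matrix (Fin 2) (Fin 2) ℂ) (t := 0) le_rfl zero_le_one (fun b => by simp) hbud₀ hbud hρ x
  rw [bgUnits_eq_unitsField]
  exact h3.1.differentiableAt

/-! ## §3 ★★★ The derivative recursion at the member, hypothesis-free -/

/-- ★★★ **px13 g6's `ℓ`-RECURSION FOR `ℓ := fderiv … 0 A`, AT THE MEMBER, WITH `hT`∕`hF` DISCHARGED**: for `RegPr F n K ε₀ W`, `10¹²L³ε₀ ≤ 1`, `k + 1 ≤ K − n`, every `y : T⁽ᵏ⁺¹⁾`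
and every direction `A`,
`fderiv ℂ (t ↦ ↑(v_{k+1}(t)(y))) 0 A = |Idx|⁻¹ • Σ_i ( fderiv ℂ (t ↦ ↑(R_{k,i}(t))) 0 A + ν_i · fderiv ℂ (t ↦ ↑(v_k(t)(x_i))) 0 A · ν_i⁻¹ )`
(family `t ↦ e^{t}·W♭`, background `W♭ = bgUnits F K W`; letters of ✓`Prop7SymFrameLinearResponseStep.fderiv_coe_frameAccU_succ_apply` VERBATIM).
[cite: Balaban1985Averaging, (97) p.32, (82) p.30, (58) p.27; Balaban1987RG1, (0.8) p.253] -/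
theorem fderiv_frameAccU_succ_apply_of_regPr {ε₀ : ℝ} (hε₀ : 0 < ε₀) (hε : 10 ^ 12 * (F.L : ℝ) ^ 3 * ε₀ ≤ 1)
    (W : GaugeField (F.P K) 0 (Matrix.specialUnitaryGroup (Fin 2) ℂ)) (hreg : RegPr F n K ε₀ W) {k : ℕ} (hk : k + 1 ≤ K - n)
    (y : Site (F.P K) (k + 1)) (A : PBond (F.P K) 0 → Matrix (Fin 2) (Fin 2) ℂ) :
    fderiv ℂ (fun t : PBond (F.P K) 0 → Matrix (Fin 2) (Fin 2) ℂ =>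
        ((frameAccU (k + 1) (bgUnits F K W) (fun b => expUnit (t b) * bgUnits F K W b) y : (Matrix (Fin 2) (Fin 2) ℂ)ˣ) : Matrix (Fin 2) (Fin 2) ℂ)) 0 A
      = (Fintype.card (Idx (F.P K)) : ℂ)⁻¹ • ∑ i : Idx (F.P K),
        (fderiv ℂ (fun t : PBond (F.P K) 0 → Matrix (Fin 2) (Fin 2) ℂ =>
            ((holT (emlIterU k (fun b => expUnit (t b) * bgUnits F K W b)) (emb y) (stairWord i.2.1 (off i.1))
              * (holT (emlIterU k (bgUnits F K W)) (emb y) (stairWord i.2.1 (off i.1)))⁻¹ : (Matrix (Fin 2) (Fin 2) ℂ)ˣ) : Matrix (Fin 2) (Fin 2) ℂ)) 0 A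
          + ((holT (emlIterU k (bgUnits F K W)) (emb y) (stairWord i.2.1 (off i.1)) : (Matrix (Fin 2) (Fin 2) ℂ)ˣ) : Matrix (Fin 2) (Fin 2) ℂ)
            * fderiv ℂ (fun t : PBond (F.P K) 0 → Matrix (Fin 2) (Fin 2) ℂ =>
                ((frameAccU k (bgUnits F K W) (fun b => expUnit (t b) * bgUnits F K W b) (transl (emb y) (disp (stairWord i.2.1 (off i.1)))) :
                  (Matrix (Fin 2) (Fin 2) ℂ)ˣ) : Matrix (Fin 2) (Fin 2) ℂ)) 0 A
            * (((holT (emlIterU k (bgUnits F K W)) (emb y) (stairWord i.2.1 (off i.1)))⁻¹ : (Matrix (Fin 2) (Fin 2) ℂ)ˣ) : Matrix (Fin 2) (Fin 2) ℂ)) :=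
  fderiv_coe_frameAccU_succ_apply (bgUnits F K W) (fun t : PBond (F.P K) 0 → Matrix (Fin 2) (Fin 2) ℂ => fun b => expUnit (t b) * bgUnits F K W b)
    (expUnit_zero_mul_bgUnits F K W) k (fun b => differentiableAt_coe_emlIterU_of_regPr hε₀ hε W hreg (Nat.le_of_succ_le hk) b)
    (fun x => differentiableAt_coe_frameAccU_of_regPr hε₀ hε W hreg (Nat.le_of_succ_le hk) x) y A

/-- ★★ **THE ONE-STEP SYMMETRIC FRAME AT THE MEMBER, HYPOTHESIS-FREE**: value `1` at `0` and
`fderiv ℂ (t ↦ ↑(w_k(t)(y))) 0 A = |Idx|⁻¹ • Σ_i (…) − fderiv ℂ (t ↦ ↑(v_k(t)(emb y))) 0 A` (✓`fderiv_coe_vframeCovU_succ_apply` with `hT`∕`hF` discharged).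
[cite: Balaban1985Averaging, (82) p.30, (97) p.32] -/
theorem fderiv_vframeCovU_succ_apply_of_regPr {ε₀ : ℝ} (hε₀ : 0 < ε₀) (hε : 10 ^ 12 * (F.L : ℝ) ^ 3 * ε₀ ≤ 1)
    (W : GaugeField (F.P K) 0 (Matrix.specialUnitaryGroup (Fin 2) ℂ)) (hreg : RegPr F n K ε₀ W) {k : ℕ} (hk : k + 1 ≤ K - n)
    (y : Site (F.P K) (k + 1)) (A : PBond (F.P K) 0 → Matrix (Fin 2) (Fin 2) ℂ) :
    vframeCovU (emlIterU k (bgUnits F K W)) (dbarCovIterU k (bgUnits F K W) (fun b => expUnit ((0 : PBond (F.P K) 0 → Matrix (Fin 2) (Fin 2) ℂ) b) * bgUnits F K W b)) y = 1 ∧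
    fderiv ℂ (fun t : PBond (F.P K) 0 → Matrix (Fin 2) (Fin 2) ℂ =>
        ((vframeCovU (emlIterU k (bgUnits F K W)) (dbarCovIterU k (bgUnits F K W) (fun b => expUnit (t b) * bgUnits F K W b)) y : (Matrix (Fin 2) (Fin 2) ℂ)ˣ) :
          Matrix (Fin 2) (Fin 2) ℂ)) 0 A
      = (Fintype.card (Idx (F.P K)) : ℂ)⁻¹ • ∑ i : Idx (F.P K),
        (fderiv ℂ (fun t : PBond (F.P K) 0 → Matrix (Fin 2) (Fin 2) ℂ =>
            ((holT (emlIterU k (fun b => expUnit (t b) * bgUnits F K W b)) (emb y) (stairWord i.2.1 (off i.1))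
              * (holT (emlIterU k (bgUnits F K W)) (emb y) (stairWord i.2.1 (off i.1)))⁻¹ : (Matrix (Fin 2) (Fin 2) ℂ)ˣ) : Matrix (Fin 2) (Fin 2) ℂ)) 0 A
          + ((holT (emlIterU k (bgUnits F K W)) (emb y) (stairWord i.2.1 (off i.1)) : (Matrix (Fin 2) (Fin 2) ℂ)ˣ) : Matrix (Fin 2) (Fin 2) ℂ)
            * fderiv ℂ (fun t : PBond (F.P K) 0 → Matrix (Fin 2) (Fin 2) ℂ =>
                ((frameAccU k (bgUnits F K W) (fun b => expUnit (t b) * bgUnits F K W b) (transl (emb y) (disp (stairWord i.2.1 (off i.1)))) :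
                  (Matrix (Fin 2) (Fin 2) ℂ)ˣ) : Matrix (Fin 2) (Fin 2) ℂ)) 0 A
            * (((holT (emlIterU k (bgUnits F K W)) (emb y) (stairWord i.2.1 (off i.1)))⁻¹ : (Matrix (Fin 2) (Fin 2) ℂ)ˣ) : Matrix (Fin 2) (Fin 2) ℂ))
        - fderiv ℂ (fun t : PBond (F.P K) 0 → Matrix (Fin 2) (Fin 2) ℂ =>
            ((frameAccU k (bgUnits F K W) (fun b => expUnit (t b) * bgUnits F K W b) (emb y) : (Matrix (Fin 2) (Fin 2) ℂ)ˣ) : Matrix (Fin 2) (Fin 2) ℂ)) 0 A :=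
  fderiv_coe_vframeCovU_succ_apply (bgUnits F K W) (fun t : PBond (F.P K) 0 → Matrix (Fin 2) (Fin 2) ℂ => fun b => expUnit (t b) * bgUnits F K W b)
    (expUnit_zero_mul_bgUnits F K W) k (fun b => differentiableAt_coe_emlIterU_of_regPr hε₀ hε W hreg (Nat.le_of_succ_le hk) b)
    (fun x => differentiableAt_coe_frameAccU_of_regPr hε₀ hε W hreg (Nat.le_of_succ_le hk) x) y A

/-- **THE PLAIN-TOWER STAIR RATIOS ARE DIFFERENTIABLE AT THE MEMBER** (FILE 3's `hW` ∕ ✓R0-LIN-S's `differentiableAt_stairRatio` with `hT` discharged), every `k ≤ K − n`.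
[cite: Balaban1985Averaging, (58) p.27] -/
theorem differentiableAt_stairRatio_of_regPr {ε₀ : ℝ} (hε₀ : 0 < ε₀) (hε : 10 ^ 12 * (F.L : ℝ) ^ 3 * ε₀ ≤ 1)
    (W : GaugeField (F.P K) 0 (Matrix.specialUnitaryGroup (Fin 2) ℂ)) (hreg : RegPr F n K ε₀ W) {k : ℕ} (hk : k ≤ K - n) (y : Site (F.P K) (k + 1)) (i : Idx (F.P K)) :
    DifferentiableAt ℂ (fun t : PBond (F.P K) 0 → Matrix (Fin 2) (Fin 2) ℂ =>
      ((holT (emlIterU k (fun b => expUnit (t b) * bgUnits F K W b)) (emb y) (stairWord i.2.1 (off i.1))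
        * (holT (emlIterU k (bgUnits F K W)) (emb y) (stairWord i.2.1 (off i.1)))⁻¹ : (Matrix (Fin 2) (Fin 2) ℂ)ˣ) : Matrix (Fin 2) (Fin 2) ℂ)) 0 :=
  differentiableAt_stairRatio (bgUnits F K W) (fun t : PBond (F.P K) 0 → Matrix (Fin 2) (Fin 2) ℂ => fun b => expUnit (t b) * bgUnits F K W b) k
    (fun b => differentiableAt_coe_emlIterU_of_regPr hε₀ hε W hreg hk b) y i

/-! ## §4 ★★★ With FILE 3: the stair-ratio linear part is `covWalkSum`, and px13's `hℓ` row is inhabited by the derivatives -/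

/-- ★★★ **THE STAIR-RATIO DERIVATIVE AT THE MEMBER IS `covWalkSum`** (✓`Prop7HolRatioLinearResponse.fderiv_holT_ratio_apply` with §2's `hT`): for `RegPr F n K ε₀ W`, `10¹²L³ε₀ ≤ 1`,
`k ≤ K − n`, and ANY level-`k` special-unitary field `V` with the background tower's values (`hV`, ✓px17 `emlIterU_eq_unitsField_iter`),
`fderiv ℂ (t ↦ ↑(R_{k,i}(t))) 0 A = covWalkSum V (b ↦ fderiv ℂ (t ↦ ↑(Ū⁽ᵏ⁾[e^{t}·W♭](b))) 0 A · (↑(V b))*) (walk (emb y) st_i)`. [cite: Balaban1985Averaging, (56)–(58) p.27, (82) p.30] -/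
theorem fderiv_stairRatio_apply_of_regPr {ε₀ : ℝ} (hε₀ : 0 < ε₀) (hε : 10 ^ 12 * (F.L : ℝ) ^ 3 * ε₀ ≤ 1)
    (W : GaugeField (F.P K) 0 (Matrix.specialUnitaryGroup (Fin 2) ℂ)) (hreg : RegPr F n K ε₀ W) {k : ℕ} (hk : k ≤ K - n)
    (V : GaugeField (F.P K) k (Matrix.specialUnitaryGroup (Fin 2) ℂ))
    (hV : ∀ b : PBond (F.P K) k, ((emlIterU k (bgUnits F K W) b : (Matrix (Fin 2) (Fin 2) ℂ)ˣ) : Matrix (Fin 2) (Fin 2) ℂ) = ((V b : Matrix.specialUnitaryGroup (Fin 2) ℂ) : Matrix (Fin 2) (Fin 2) ℂ))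
    (y : Site (F.P K) (k + 1)) (i : Idx (F.P K)) (A : PBond (F.P K) 0 → Matrix (Fin 2) (Fin 2) ℂ) :
    fderiv ℂ (fun t : PBond (F.P K) 0 → Matrix (Fin 2) (Fin 2) ℂ =>
        ((holT (emlIterU k (fun b => expUnit (t b) * bgUnits F K W b)) (emb y) (stairWord i.2.1 (off i.1))
          * (holT (emlIterU k (bgUnits F K W)) (emb y) (stairWord i.2.1 (off i.1)))⁻¹ : (Matrix (Fin 2) (Fin 2) ℂ)ˣ) : Matrix (Fin 2) (Fin 2) ℂ)) 0 A
      = covWalkSum V (fun b => fderiv ℂ (fun t : PBond (F.P K) 0 → Matrix (Fin 2) (Fin 2) ℂ =>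
          ((emlIterU k (fun b' => expUnit (t b') * bgUnits F K W b') b : (Matrix (Fin 2) (Fin 2) ℂ)ˣ) : Matrix (Fin 2) (Fin 2) ℂ)) 0 A
            * star ((V b : Matrix.specialUnitaryGroup (Fin 2) ℂ) : Matrix (Fin 2) (Fin 2) ℂ)) (walk (emb y) (stairWord i.2.1 (off i.1))) := by
  have h0 : emlIterU k (fun b => expUnit ((0 : PBond (F.P K) 0 → Matrix (Fin 2) (Fin 2) ℂ) b) * bgUnits F K W b) = emlIterU k (bgUnits F K W) := by
    rw [expUnit_zero_mul_bgUnits]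
  have hWa : ∀ b : PBond (F.P K) k, (((fun t : PBond (F.P K) 0 → Matrix (Fin 2) (Fin 2) ℂ => emlIterU k (fun b => expUnit (t b) * bgUnits F K W b)) 0 b :
      (Matrix (Fin 2) (Fin 2) ℂ)ˣ) : Matrix (Fin 2) (Fin 2) ℂ) = ((V b : Matrix.specialUnitaryGroup (Fin 2) ℂ) : Matrix (Fin 2) (Fin 2) ℂ) := fun b => by
    show ((emlIterU k (fun b => expUnit ((0 : PBond (F.P K) 0 → Matrix (Fin 2) (Fin 2) ℂ) b) * bgUnits F K W b) b : (Matrix (Fin 2) (Fin 2) ℂ)ˣ) :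
      Matrix (Fin 2) (Fin 2) ℂ) = _
    rw [h0]; exact hV b
  have h := (fderiv_holT_ratio_apply V (fun t : PBond (F.P K) 0 → Matrix (Fin 2) (Fin 2) ℂ => emlIterU k (fun b => expUnit (t b) * bgUnits F K W b)) (a := 0)
    hWa (fun b => differentiableAt_coe_emlIterU_of_regPr hε₀ hε W hreg hk b) (stairWord i.2.1 (off i.1)) (emb y) A).2
  simp only [h0] at h
  exact h

/-- ★★★ **px13 g6's F-γ2 ROW `hℓ`, INHABITED BY THE DERIVATIVES** (§3 ∘ `fderiv_stairRatio_apply_of_regPr`): for `RegPr F n K ε₀ W`, `10¹²L³ε₀ ≤ 1`, `k + 1 ≤ K − n`, any level-`k`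
`SU(2)` field `V` with the background tower's values, every `y` and direction `A`,
`fderiv ℂ (t ↦ ↑(v_{k+1}(t)(y))) 0 A = |Idx|⁻¹ • Σ_i ( covWalkSum V ℓY (walk (emb y) st_i) + ν_i · fderiv ℂ (t ↦ ↑(v_k(t)(x_i))) 0 A · ν_i⁻¹ )`,
`ℓY b := fderiv ℂ (t ↦ ↑(Ū⁽ᵏ⁾[e^{t}·W♭](b))) 0 A · (↑(V b))*` — the letters of `Prop7FrameRem2RecursionT3.frameRem2_recursion_T3`'s `hℓ` with `ℓ := fderiv`.
[cite: Balaban1985Averaging, (97) p.32, (82) p.30, (56)–(58) p.27; Balaban1987RG1, (0.8) p.253] -/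
theorem fderiv_frameAccU_succ_apply_covWalkSum_of_regPr {ε₀ : ℝ} (hε₀ : 0 < ε₀) (hε : 10 ^ 12 * (F.L : ℝ) ^ 3 * ε₀ ≤ 1)
    (W : GaugeField (F.P K) 0 (Matrix.specialUnitaryGroup (Fin 2) ℂ)) (hreg : RegPr F n K ε₀ W) {k : ℕ} (hk : k + 1 ≤ K - n)
    (V : GaugeField (F.P K) k (Matrix.specialUnitaryGroup (Fin 2) ℂ))
    (hV : ∀ b : PBond (F.P K) k, ((emlIterU k (bgUnits F K W) b : (Matrix (Fin 2) (Fin 2) ℂ)ˣ) : Matrix (Fin 2) (Fin 2) ℂ) = ((V b : Matrix.specialUnitaryGroup (Fin 2) ℂ) : Matrix (Fin 2) (Fin 2) ℂ))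
    (y : Site (F.P K) (k + 1)) (A : PBond (F.P K) 0 → Matrix (Fin 2) (Fin 2) ℂ) :
    fderiv ℂ (fun t : PBond (F.P K) 0 → Matrix (Fin 2) (Fin 2) ℂ =>
        ((frameAccU (k + 1) (bgUnits F K W) (fun b => expUnit (t b) * bgUnits F K W b) y : (Matrix (Fin 2) (Fin 2) ℂ)ˣ) : Matrix (Fin 2) (Fin 2) ℂ)) 0 A
      = (Fintype.card (Idx (F.P K)) : ℂ)⁻¹ • ∑ i : Idx (F.P K),
        (covWalkSum V (fun b => fderiv ℂ (fun t : PBond (F.P K) 0 → Matrix (Fin 2) (Fin 2) ℂ =>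
            ((emlIterU k (fun b' => expUnit (t b') * bgUnits F K W b') b : (Matrix (Fin 2) (Fin 2) ℂ)ˣ) : Matrix (Fin 2) (Fin 2) ℂ)) 0 A
              * star ((V b : Matrix.specialUnitaryGroup (Fin 2) ℂ) : Matrix (Fin 2) (Fin 2) ℂ)) (walk (emb y) (stairWord i.2.1 (off i.1)))
          + ((holT (emlIterU k (bgUnits F K W)) (emb y) (stairWord i.2.1 (off i.1)) : (Matrix (Fin 2) (Fin 2) ℂ)ˣ) : Matrix (Fin 2) (Fin 2) ℂ)
            * fderiv ℂ (fun t : PBond (F.P K) 0 → Matrix (Fin 2) (Fin 2) ℂ =>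
                ((frameAccU k (bgUnits F K W) (fun b => expUnit (t b) * bgUnits F K W b) (transl (emb y) (disp (stairWord i.2.1 (off i.1)))) :
                  (Matrix (Fin 2) (Fin 2) ℂ)ˣ) : Matrix (Fin 2) (Fin 2) ℂ)) 0 A
            * (((holT (emlIterU k (bgUnits F K W)) (emb y) (stairWord i.2.1 (off i.1)))⁻¹ : (Matrix (Fin 2) (Fin 2) ℂ)ˣ) : Matrix (Fin 2) (Fin 2) ℂ)) := by
  rw [fderiv_frameAccU_succ_apply_of_regPr hε₀ hε W hreg hk y A]
  refine congrArg _ (Finset.sum_congr rfl fun i _ => ?_)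
  rw [fderiv_stairRatio_apply_of_regPr hε₀ hε W hreg (Nat.le_of_succ_le hk) V hV y i A]

end Summit.QuantumFields.YangMills.Theorems.Prop7SymFrameLinearResponseOfRegPr

end
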